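import Literature.Probability.Independence.LatticeLocalLimitTheorem
import HarnessLib

/-!
# The first display of the lattice local limit theorem, MODEL-FREE: `|s·μ{m} − n((m − c)/s)| ≤ (1/2π)∫‖𝟙ψ − e^{−θ²/2}‖`

Topic `Literature/Probability/Independence` (continues `LatticeLocalLimitTheorem.lean` — Durrett's Theorem 3.5.3 for i.i.d. sums: the inversion on a
lattice `Durrett2019_ex_3_3_2_lattice`, the Gaussian density as a Fourier integral `gaussianDensity_eq_integral_cexp`, and the subtraction step
`abs_sqrt_div_mul_prob_sum_sub_gaussian_le`, which is written for `S_n/√n`).  THIS FILE isolates the subtraction step for an ARBITRARY integer-valued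
law `μ`, an arbitrary scale `s > 0` and centring `c` (for the lane's strip statistics `s = σ√N`, `c = N·b`, and `ψ` below is the characteristic
function of the standardised law, controlled by `…WidthOneContactBerryEsseen` on the windows and by `…WidthOneOffAxisDecay` on the arc):

* `scaled_atom_eq_integral` — `s·μ{m} = (1/2π)∫ e^{−iθx}·𝟙_{[−πs,πs]}(θ)·ψ(θ) dθ` with `x = (m − c)/s`, `ψ(θ) = φ_μ(θ/s)·e^{−iθc/s}` (inversion on
  `ℤ` and the substitution `t = θ/s`).
* ★★ `abs_scaled_atom_sub_gaussian_le` — `|s·μ{m} − (2π)^{−1/2}e^{−x²/2}| ≤ (1/2π)∫‖𝟙_{[−πs,πs]}ψ − e^{−θ²/2}‖ dθ`, the right-hand side independent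
  of `m`; ★ `abs_scaled_atom_sub_gaussian_le'` — the same split into `∫_{[−πs,πs]}‖ψ − e^{−θ²/2}‖ + ∫_{[−πs,πs]ᶜ} e^{−θ²/2}`.

## Sources
R. Durrett, *Probability: Theory and Examples* (2019) §3.5, proof of Theorem 3.5.3 (first two displays), §3.3 Exercise 3.3.2 (iii).  Lane statement
(model-free form; lane «pcv-sawmu», a-p5 g28); nothing is quoted AS PRINTED.
-/

noncomputable section

open MeasureTheory ProbabilityTheory Filter Complex Set
open Literature.Probability.Distributions
open scoped Topology Real ENNReal

namespace Literature.Probability.Independence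

variable {μ : Measure ℝ}

/-- **`s·μ{m}` as a Fourier integral**: for an integer-valued probability law `μ`, `s > 0`, `c ∈ ℝ`, `m ∈ ℤ`, with `x = (m − c)/s`:
`s·μ{m} = (1/2π) ∫ e^{−iθx}·𝟙_{[−πs, πs]}(θ)·φ_μ(θ/s)e^{−iθc/s} dθ`. [cite: Durrett2019, §3.5 proof of Theorem 3.5.3 (first display; lane form)] -/
theorem scaled_atom_eq_integral (μ : Measure ℝ) [IsProbabilityMeasure μ] (hlat : ∀ᵐ y ∂μ, ∃ k : ℤ, y = 0 + 1 * (k : ℝ))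
    {s : ℝ} (hs : 0 < s) (c : ℝ) (m : ℤ) :
    (((s * μ.real {(m : ℝ)} : ℝ)) : ℂ) =
      (1 / (2 * π) : ℂ) * ∫ θ : ℝ, cexp (-((θ : ℂ) * (((m : ℝ) - c) / s : ℝ) * I)) *
        (Icc (-(π * s)) (π * s)).indicator (fun θ => charFun μ (θ / s) * cexp (-((θ : ℂ) * ((c / s : ℝ) : ℂ) * I))) θ := by
  have hinv := Durrett2019_ex_3_3_2_lattice μ one_pos 0 hlat m
  have hm : ((0 : ℝ) + 1 * (m : ℝ)) = (m : ℝ) := by ring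
  rw [hm] at hinv
  push_cast at hinv
  simp only [zero_add, one_mul] at hinv
  -- the substitution `t = θ/s`
  have hsub : (∫ t in -(π / (1 : ℝ))..(π / (1 : ℝ)), cexp (-((t : ℂ) * (m : ℂ) * I)) * charFun μ t)
      = (s : ℂ)⁻¹ * ∫ θ in -(π * s)..(π * s), cexp (-(((θ / s : ℝ) : ℂ) * (m : ℂ) * I)) * charFun μ (θ / s) := by
    have h := intervalIntegral.integral_comp_div (a := -(π * s)) (b := π * s)
      (fun t : ℝ => cexp (-((t : ℂ) * (m : ℂ) * I)) * charFun μ t) hs.ne'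
    rw [show -(π * s) / s = -π by field_simp, show π * s / s = π by field_simp] at h
    rw [div_one, h, Complex.real_smul, ← mul_assoc, inv_mul_cancel₀ (by exact_mod_cast hs.ne' : (s : ℂ) ≠ 0), one_mul]
  push_cast
  rw [hinv, hsub]
  have hle : -(π * s) ≤ π * s := by linarith [mul_pos Real.pi_pos hs]
  rw [intervalIntegral.integral_of_le hle, ← integral_Icc_eq_integral_Ioc, ← integral_indicator measurableSet_Icc]
  have hsC : (s : ℂ) ≠ 0 := by exact_mod_cast hs.ne'
  have hfun : (fun θ : ℝ => (Icc (-(π * s)) (π * s)).indicator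
      (fun θ : ℝ => cexp (-(((θ / s : ℝ) : ℂ) * (m : ℂ) * I)) * charFun μ (θ / s)) θ) =
      fun θ : ℝ => cexp (-((θ : ℂ) * ((((m : ℝ) - c) / s : ℝ) : ℂ) * I)) *
        (Icc (-(π * s)) (π * s)).indicator (fun θ => charFun μ (θ / s) * cexp (-((θ : ℂ) * ((c / s : ℝ) : ℂ) * I))) θ := by
    funext θ
    by_cases hθ : θ ∈ Icc (-(π * s)) (π * s)
    · rw [indicator_of_mem hθ, indicator_of_mem hθ]
      have hexp : cexp (-(((θ / s : ℝ) : ℂ) * (m : ℂ) * I))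
          = cexp (-((θ : ℂ) * ((((m : ℝ) - c) / s : ℝ) : ℂ) * I)) * cexp (-((θ : ℂ) * ((c / s : ℝ) : ℂ) * I)) := by
        rw [← Complex.exp_add]
        congr 1
        push_cast
        field_simp
        ring
      rw [hexp]
      ring
    · rw [indicator_of_notMem hθ, indicator_of_notMem hθ, mul_zero]
  rw [hfun]
  push_cast
  rw [mul_left_comm, mul_inv_cancel_left₀ hsC]

/-- ★★ **THE FIRST DISPLAY OF THE LATTICE LOCAL LIMIT THEOREM, MODEL-FREE.**  For an integer-valued probability law `μ`, `s > 0`, `c ∈ ℝ` and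
`m ∈ ℤ`, with `x = (m − c)/s` and `ψ(θ) = φ_μ(θ/s)e^{−iθc/s}` (the characteristic function of `(X − c)/s`):
`|s·μ{m} − (2π)^{−1/2}e^{−x²/2}| ≤ (1/2π)·∫ ‖𝟙_{[−πs,πs]}(θ)ψ(θ) − e^{−θ²/2}‖ dθ` — the right-hand side does not depend on `m`.
[cite: Durrett2019, §3.5 proof of Theorem 3.5.3 (the subtraction step; lane form)] -/
theorem abs_scaled_atom_sub_gaussian_le (μ : Measure ℝ) [IsProbabilityMeasure μ] (hlat : ∀ᵐ y ∂μ, ∃ k : ℤ, y = 0 + 1 * (k : ℝ))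
    {s : ℝ} (hs : 0 < s) (c : ℝ) (m : ℤ) :
    |s * μ.real {(m : ℝ)} - (Real.sqrt (2 * π))⁻¹ * Real.exp (-(((m : ℝ) - c) / s) ^ 2 / 2)|
      ≤ 1 / (2 * π) * ∫ θ : ℝ, ‖(Icc (-(π * s)) (π * s)).indicator
          (fun θ => charFun μ (θ / s) * cexp (-((θ : ℂ) * ((c / s : ℝ) : ℂ) * I))) θ - cexp (-((θ : ℂ) ^ 2 / 2))‖ := by
  set x : ℝ := ((m : ℝ) - c) / s with hx
  set S : Set ℝ := Icc (-(π * s)) (π * s) with hS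
  set ψ : ℝ → ℂ := fun θ => charFun μ (θ / s) * cexp (-((θ : ℂ) * ((c / s : ℝ) : ℂ) * I)) with hψ
  set g : ℝ → ℂ := fun θ => cexp (-((θ : ℂ) ^ 2 / 2)) with hg
  set e : ℝ → ℂ := fun θ => cexp (-((θ : ℂ) * x * I)) with he
  have hen : ∀ θ, ‖e θ‖ = 1 := fun θ => by
    rw [he]; simp only
    rw [show -((θ : ℂ) * x * I) = ((-(θ * x) : ℝ) : ℂ) * I by push_cast; ring, norm_exp_ofReal_mul_I]
  have he_cont : Continuous e := by rw [he]; fun_prop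
  have hg_cont : Continuous g := by rw [hg]; fun_prop
  have hψ_cont : Continuous ψ := by
    rw [hψ]
    exact (continuous_charFun.comp (continuous_id.div_const s)).mul (by fun_prop)
  have hg_norm : ∀ θ, ‖g θ‖ = Real.exp (-(1 / 2 * θ ^ 2)) := by
    intro θ; rw [hg]; simp only
    rw [show (-((θ : ℂ) ^ 2 / 2)) = ((-(1 / 2 * θ ^ 2) : ℝ) : ℂ) by push_cast; ring, Complex.norm_exp, Complex.ofReal_re]
  have h1 := scaled_atom_eq_integral μ hlat hs c m
  have h2 := gaussianDensity_eq_integral_cexp one_pos x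
  have h2' : ((((Real.sqrt (2 * π))⁻¹ * Real.exp (-x ^ 2 / 2) : ℝ)) : ℂ)
      = (1 / (2 * π) : ℂ) * ∫ θ : ℝ, e θ * g θ := by
    have e1 : Real.sqrt (2 * π * (1 : ℝ) ^ 2) = Real.sqrt (2 * π) := by rw [one_pow, mul_one]
    have e2 : -x ^ 2 / (2 * (1 : ℝ) ^ 2) = -x ^ 2 / 2 := by ring
    rw [e1, e2] at h2
    rw [h2, he, hg]
    congr 1
    refine integral_congr_ae (ae_of_all _ fun θ => ?_)
    simp only
    congr 2
    push_cast; ring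
  -- integrability
  have hf_int : Integrable (fun θ => e θ * S.indicator ψ θ) := by
    have : (fun θ => e θ * S.indicator ψ θ) = S.indicator (fun θ => e θ * ψ θ) := by
      funext θ
      by_cases hθ : θ ∈ S
      · rw [indicator_of_mem hθ, indicator_of_mem hθ]
      · rw [indicator_of_notMem hθ, indicator_of_notMem hθ, mul_zero]
    rw [this]
    exact ((he_cont.mul hψ_cont).integrableOn_Icc).integrable_indicator measurableSet_Icc
  have hgauss : Integrable (fun θ : ℝ => Real.exp (-(1 / 2 * θ ^ 2))) := by
    simpa [neg_mul] using integrable_exp_neg_mul_sq (by norm_num : (0 : ℝ) < 1 / 2)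
  have hg_int : Integrable (fun θ => e θ * g θ) := by
    refine hgauss.mono' (he_cont.mul hg_cont).aestronglyMeasurable (ae_of_all _ fun θ => ?_)
    rw [norm_mul, hen, one_mul, hg_norm]
  -- subtract
  have hdiff : (((s * μ.real {(m : ℝ)} - (Real.sqrt (2 * π))⁻¹ * Real.exp (-x ^ 2 / 2) : ℝ)) : ℂ)
      = (1 / (2 * π) : ℂ) * ∫ θ, e θ * (S.indicator ψ θ - g θ) := by
    rw [Complex.ofReal_sub, h1, h2', ← mul_sub, ← integral_sub hf_int hg_int]
    congr 1
    refine integral_congr_ae (ae_of_all _ fun θ => ?_)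
    simp only [he, hS, hψ, hx]
    ring
  have hnorm := congrArg (fun w : ℂ => ‖w‖) hdiff
  simp only [Complex.norm_real, Real.norm_eq_abs] at hnorm
  rw [hnorm, norm_mul, show ‖(1 / (2 * π) : ℂ)‖ = 1 / (2 * π) by
    rw [show (1 / (2 * π) : ℂ) = ((1 / (2 * π) : ℝ) : ℂ) by push_cast; ring, Complex.norm_real,
      Real.norm_eq_abs, abs_of_pos (by positivity)]]
  gcongr
  calc ‖∫ θ, e θ * (S.indicator ψ θ - g θ)‖ ≤ ∫ θ, ‖e θ * (S.indicator ψ θ - g θ)‖ := norm_integral_le_integral_norm _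
    _ = ∫ θ, ‖S.indicator ψ θ - g θ‖ := by
        congr 1; funext θ; rw [norm_mul, hen, one_mul]

/-- ★ **The two-integral form**: `|s·μ{m} − (2π)^{−1/2}e^{−x²/2}| ≤ (1/2π)·(∫_{[−πs,πs]}‖ψ − e^{−θ²/2}‖ + ∫_{[−πs,πs]ᶜ} e^{−θ²/2})`.
[cite: Durrett2019, §3.5 proof of Theorem 3.5.3 (second display; lane form)] -/
theorem abs_scaled_atom_sub_gaussian_le' (μ : Measure ℝ) [IsProbabilityMeasure μ] (hlat : ∀ᵐ y ∂μ, ∃ k : ℤ, y = 0 + 1 * (k : ℝ))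
    {s : ℝ} (hs : 0 < s) (c : ℝ) (m : ℤ) :
    |s * μ.real {(m : ℝ)} - (Real.sqrt (2 * π))⁻¹ * Real.exp (-(((m : ℝ) - c) / s) ^ 2 / 2)|
      ≤ 1 / (2 * π) * ((∫ θ in Icc (-(π * s)) (π * s),
          ‖charFun μ (θ / s) * cexp (-((θ : ℂ) * ((c / s : ℝ) : ℂ) * I)) - cexp (-((θ : ℂ) ^ 2 / 2))‖)
        + ∫ θ in (Icc (-(π * s)) (π * s))ᶜ, Real.exp (-(θ ^ 2 / 2))) := by
  refine (abs_scaled_atom_sub_gaussian_le μ hlat hs c m).trans (le_of_eq ?_)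
  congr 1
  have hψ : Continuous fun θ : ℝ => charFun μ (θ / s) * cexp (-((θ : ℂ) * ((c / s : ℝ) : ℂ) * I)) :=
    (continuous_charFun.comp (continuous_id.div_const s)).mul (by fun_prop)
  have hg : Integrable fun θ : ℝ => cexp (-((θ : ℂ) ^ 2 / 2)) := by
    have := integrable_cexp_quadratic (b := (1 : ℂ) / 2) (by norm_num) 0 0
    refine this.congr (ae_of_all _ fun θ => ?_)
    simp only [zero_mul, add_zero]
    congr 1; ring
  have hint : Integrable (fun θ => ‖(Icc (-(π * s)) (π * s)).indicator
      (fun θ => charFun μ (θ / s) * cexp (-((θ : ℂ) * ((c / s : ℝ) : ℂ) * I))) θ - cexp (-((θ : ℂ) ^ 2 / 2))‖) :=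
    ((hψ.integrableOn_Icc.integrable_indicator measurableSet_Icc).sub hg).norm
  rw [← integral_add_compl (measurableSet_Icc (a := -(π * s)) (b := π * s)) hint]
  congr 1
  · refine setIntegral_congr_fun measurableSet_Icc fun θ hθ => ?_
    simp only [indicator_of_mem hθ]
  · refine setIntegral_congr_fun measurableSet_Icc.compl fun θ hθ => ?_
    simp only [indicator_of_notMem (show θ ∉ Icc (-(π * s)) (π * s) from hθ), zero_sub, norm_neg]
    rw [show (-((θ : ℂ) ^ 2 / 2)) = ((-(θ ^ 2 / 2) : ℝ) : ℂ) by push_cast; ring, Complex.norm_exp, Complex.ofReal_re]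

end Literature.Probability.Independence

end
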